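import Std.Sat.CNF
import Mathlib.Data.Nat.Bitwise
import Summits.Ventures.QEC.Census.KernelReplay
import HarnessLib

/-!
# A faster kernel-tier RUP replayer for `Std.Sat.CNF Nat` refutations (clause bit-masks, raw recursors)

Cell `qec`, PARTITION row type-11 (K2 half of the certificate checker: the LRAT/RUP hook, KERNEL tier).
`Census/KernelReplay.lean` bridges `Std.Sat.CNF ℕ` to the tree's kernel RUP checker `KRup`
(`Summits/Ventures/DiscreteObjects/UnitDistance/KernelRupCheck.lean`), measured at ≈ 1.5 ms per hint
under `decide +kernel` on the `[[144,12,12]]` kernel-B leaves.  This file is a drop-in replacement with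
the SAME input convention (literal `2x` = variable `x` true, `2x+1` = false; clause ids `1 … m` for the
original clauses in array order, derived clauses `m+1, m+2, …` in step order; steps `(clause, hints)`;
RAT steps unsupported) that the kernel evaluates ≈ 4–5× faster (measured 0.32 ms/hint + ≈ 3 s per
module on the same leaves), obtained by three changes, none of which the soundness proof depends on:

* clauses are stored as BIT-MASKS over the literals (`maskOf C = Σ_{l ∈ C} 2^l`); the RUP state is the
  mask `F` of currently FALSIFIED literals; for a hinted clause `D` the non-falsified part is
  `live D F = D ^^^ (D &&& F)`: `0` = conflict, a power of two (`x &&& (x-1) = 0`) = unit, whose partner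
  literal `2v ↔ 2v+1` is falsified by the constant-time `swapPair E x` (`E` = mask of the even bit
  positions, `evenMask N`) — every operation is a GMP-accelerated kernel `Nat` primitive, no per-literal
  recursion;
* all recursion is written with the RAW RECURSORS `Store.rec` / `Nat.rec` / `List.rec` (no `brecOn`
  tupling) and all branching with `cond` on `Nat.beq` / `Nat.ble` (no `Decidable` instances);
* a hinted id that holds no clause (`get = 0`) FAILS the check (the mask `0` would otherwise read as a
  conflict).

SOUNDNESS is in the companion `Census/KernelReplayFastSound.lean` (`checkAll_sound`,
`unsat_of_kernelRupFast`, and the chain lemmas `all_advance_of_checkAll` / `false_of_checkAll_of_hasEmpty`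
for one LRAT proof split over several modules); as for `KRup` it uses only "every mask fetched from the
store was inserted", never the trie's indexing.  This file: the checker, its `rfl` unfolding equations,
and the bit lemmas (`testBit_maskOf`, `testBit_live`, `testBit_evenMask`, `eq_neg_of_testBit_swapPair`).
The mask `E` is a parameter (emit it as a literal and discharge `E = evenMask N` once by `decide`;
passing the term `evenMask N` itself is sound but re-evaluated by the kernel at every step).
-/

namespace Summit.Ventures.QEC.Census.KRupFast

open Std.Sat Summit.Ventures.DiscreteObjects.UnitDistance

/-! ## The checker (raw recursors; evaluated by `decide +kernel`) -/

/-- Binary trie of clause bit-masks keyed by clause id (`0` = nothing stored). -/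
inductive Store where
  | nil : Store
  | node : Store → ℕ → Store → Store

/-- Lookup by id `k ≥ 1` (binary digits of `k`, least significant first); `0` when absent. -/
noncomputable def Store.get (t : Store) : ℕ → ℕ :=
  Store.rec (motive := fun _ => ℕ → ℕ) (fun _ => 0)
    (fun _ v _ gl gr k =>
      cond (Nat.ble k 1) v (cond (Nat.beq (Nat.mod k 2) 0) (gl (Nat.div k 2)) (gr (Nat.div k 2))))
    t

/-- Insert mask `C` at id `k ≥ 1` (`d` = depth fuel, more than the number of binary digits of `k`). -/
noncomputable def Store.ins (d : ℕ) : Store → ℕ → ℕ → Store :=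
  Nat.rec (motive := fun _ => Store → ℕ → ℕ → Store) (fun t _ _ => t)
    (fun _ insd t k C =>
      Store.rec (motive := fun _ => Store)
        (cond (Nat.ble k 1) (.node .nil C .nil)
          (cond (Nat.beq (Nat.mod k 2) 0) (.node (insd .nil (Nat.div k 2) C) 0 .nil)
            (.node .nil 0 (insd .nil (Nat.div k 2) C))))
        (fun l v r _ _ =>
          cond (Nat.ble k 1) (.node l C r)
            (cond (Nat.beq (Nat.mod k 2) 0) (.node (insd l (Nat.div k 2) C) v r)
              (.node l v (insd r (Nat.div k 2) C))))
        t)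
    d

/-- Bit-mask of a clause: `Σ_{l ∈ C} 2^l`. -/
noncomputable def maskOf (C : List ℕ) : ℕ :=
  List.rec (motive := fun _ => ℕ) 0 (fun l _ acc => Nat.lor acc (Nat.pow 2 l)) C

/-- Insert the masks of a clause list at ids `i, i+1, …`. -/
noncomputable def Store.insClauses (d : ℕ) (t : Store) (i : ℕ) (L : List (List ℕ)) : Store :=
  List.rec (motive := fun _ => Store → ℕ → Store) (fun t _ => t)
    (fun C _ k t i => k (Store.ins d t i (maskOf C)) (i + 1)) L t i

/-- The store of a clause list with ids `1, 2, …`. -/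
noncomputable def Store.ofClauses (d : ℕ) (L : List (List ℕ)) : Store := Store.insClauses d .nil 1 L

/-- Mask of the even bit positions `0, 2, …, 2N-2`: `Σ_{v<N} 4^v`. -/
def evenMask : ℕ → ℕ
  | 0 => 0
  | N + 1 => evenMask N ||| 2 ^ (2 * N)

/-- Move every bit to its partner position `2v ↔ 2v+1` (`E` = even-position mask). -/
def swapPair (E x : ℕ) : ℕ :=
  Nat.lor (Nat.shiftLeft (Nat.land x E) 1) (Nat.land (Nat.shiftRight x 1) E)

/-- The non-falsified literals of clause mask `D` under the falsified-literal mask `F`. -/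
def live (D F : ℕ) : ℕ := Nat.xor D (Nat.land D F)

/-- Follow the hints from the falsified-literal mask `F`: each hinted clause must be stored and, minus
the falsified literals, be EMPTY (conflict — success) or a SINGLE literal (unit — its partner literal
becomes falsified).  `f` = hint fuel. -/
noncomputable def rup (S : Store) (E f : ℕ) : ℕ → List ℕ → Bool :=
  Nat.rec (motive := fun _ => ℕ → List ℕ → Bool) (fun _ _ => false)
    (fun _ rec F hs =>
      List.rec (motive := fun _ => Bool) false
        (fun h hs' _ =>
          let D := S.get h
          cond (Nat.beq D 0) false
            (let x := live D F
             cond (Nat.beq x 0) true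
              (cond (Nat.beq (Nat.land x (Nat.sub x 1)) 0)
                (rec (Nat.lor F (swapPair E x)) hs') false)))
        hs)
    f

/-- Check the steps `(C, hints)` in order: RUP for `C` from "every literal of `C` falsified"
(`F := maskOf C`), then insert `maskOf C` at the next id (`i, i+1, …`; `d` = trie depth fuel). -/
noncomputable def checkAll (f d E : ℕ) (S : Store) (i : ℕ) (steps : List (List ℕ × List ℕ)) : Bool :=
  List.rec (motive := fun _ => Store → ℕ → Bool) (fun _ _ => true)
    (fun st _ k S i => rup S E f (maskOf st.1) st.2 && k (Store.ins d S i (maskOf st.1)) (i + 1))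
    steps S i

/-- The store after the steps (their clauses inserted at `i, i+1, …`; nothing checked). -/
noncomputable def advance (d : ℕ) (S : Store) (i : ℕ) (steps : List (List ℕ × List ℕ)) : Store :=
  List.rec (motive := fun _ => Store → ℕ → Store) (fun S _ => S)
    (fun st _ k S i => k (Store.ins d S i (maskOf st.1)) (i + 1)) steps S i

/-- Some step derives the EMPTY clause. -/
noncomputable def hasEmpty (steps : List (List ℕ × List ℕ)) : Bool :=
  List.rec (motive := fun _ => Bool) false
    (fun st _ b => List.rec (motive := fun _ => Bool) true (fun _ _ _ => false) st.1 || b) steps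

/-- KERNEL REPLAY VERDICT for a `CNF ℕ` (conventions of `Census/KernelReplay.lean`: original clauses get
ids `1 … m` in array order, derived clauses `m+1, …`; `f` = hint fuel, `d` = trie depth fuel, `E` = an
`evenMask N` literal): all steps check AND some derived clause is empty. -/
noncomputable def kernelRupFast (f d E : ℕ) (cnf : CNF Nat) (steps : List (List ℕ × List ℕ)) : Bool :=
  checkAll f d E (Store.ofClauses d (KernelReplay.cnfToKRup cnf)) (cnf.clauses.size + 1) steps &&
    hasEmpty steps

/-! ## Unfolding equations (all `rfl`) -/

/-- `get` on the empty trie. -/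
theorem get_nil (k : ℕ) : Store.nil.get k = 0 := rfl

/-- `get` on a node (unfolding equation). -/
theorem get_node (l : Store) (v : ℕ) (r : Store) (k : ℕ) :
    (Store.node l v r).get k =
      cond (Nat.ble k 1) v (cond (Nat.beq (Nat.mod k 2) 0) (l.get (Nat.div k 2)) (r.get (Nat.div k 2))) :=
  rfl

/-- `ins` with no depth fuel. -/
theorem ins_zero (t : Store) (k C : ℕ) : Store.ins 0 t k C = t := rfl

/-- `ins` into the empty trie (unfolding equation). -/
theorem ins_succ_nil (d k C : ℕ) :
    Store.ins (d + 1) .nil k C =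
      cond (Nat.ble k 1) (.node .nil C .nil)
        (cond (Nat.beq (Nat.mod k 2) 0) (.node (Store.ins d .nil (Nat.div k 2) C) 0 .nil)
          (.node .nil 0 (Store.ins d .nil (Nat.div k 2) C))) :=
  rfl

/-- `ins` into a node (unfolding equation). -/
theorem ins_succ_node (d : ℕ) (l : Store) (v : ℕ) (r : Store) (k C : ℕ) :
    Store.ins (d + 1) (.node l v r) k C =
      cond (Nat.ble k 1) (.node l C r)
        (cond (Nat.beq (Nat.mod k 2) 0) (.node (Store.ins d l (Nat.div k 2) C) v r)
          (.node l v (Store.ins d r (Nat.div k 2) C))) :=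
  rfl

/-- Mask of the empty clause. -/
theorem maskOf_nil : maskOf [] = 0 := rfl

/-- Mask of a cons (unfolding equation). -/
theorem maskOf_cons (l : ℕ) (C : List ℕ) : maskOf (l :: C) = maskOf C ||| 2 ^ l := rfl

/-- `insClauses` of no clauses. -/
theorem insClauses_nil (d : ℕ) (t : Store) (i : ℕ) : Store.insClauses d t i [] = t := rfl

/-- `insClauses` of a cons (unfolding equation). -/
theorem insClauses_cons (d : ℕ) (t : Store) (i : ℕ) (C : List ℕ) (L : List (List ℕ)) :
    Store.insClauses d t i (C :: L) = Store.insClauses d (Store.ins d t i (maskOf C)) (i + 1) L := rfl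

/-- `rup` with no hint fuel fails. -/
theorem rup_zero (S : Store) (E F : ℕ) (hs : List ℕ) : rup S E 0 F hs = false := rfl

/-- `rup` out of hints fails. -/
theorem rup_succ_nil (S : Store) (E f F : ℕ) : rup S E (f + 1) F [] = false := rfl

/-- `rup` on a hint (unfolding equation). -/
theorem rup_succ_cons (S : Store) (E f F h : ℕ) (hs : List ℕ) :
    rup S E (f + 1) F (h :: hs) =
      cond (Nat.beq (S.get h) 0) false
        (cond (Nat.beq (live (S.get h) F) 0) true
          (cond (Nat.beq (Nat.land (live (S.get h) F) (Nat.sub (live (S.get h) F) 1)) 0)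
            (rup S E f (Nat.lor F (swapPair E (live (S.get h) F))) hs) false)) :=
  rfl

/-- `checkAll` of no steps succeeds. -/
theorem checkAll_nil (f d E : ℕ) (S : Store) (i : ℕ) : checkAll f d E S i [] = true := rfl

/-- `checkAll` of a cons (unfolding equation). -/
theorem checkAll_cons (f d E : ℕ) (S : Store) (i : ℕ) (st : List ℕ × List ℕ)
    (rest : List (List ℕ × List ℕ)) :
    checkAll f d E S i (st :: rest) =
      (rup S E f (maskOf st.1) st.2 && checkAll f d E (Store.ins d S i (maskOf st.1)) (i + 1) rest) :=
  rfl

/-- `advance` of no steps. -/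
theorem advance_nil (d : ℕ) (S : Store) (i : ℕ) : advance d S i [] = S := rfl

/-- `advance` of a cons (unfolding equation). -/
theorem advance_cons (d : ℕ) (S : Store) (i : ℕ) (st : List ℕ × List ℕ) (rest : List (List ℕ × List ℕ)) :
    advance d S i (st :: rest) = advance d (Store.ins d S i (maskOf st.1)) (i + 1) rest := rfl

/-- `hasEmpty` of no steps. -/
theorem hasEmpty_nil : hasEmpty [] = false := rfl

/-- `hasEmpty` of a cons (unfolding equation). -/
theorem hasEmpty_cons (st : List ℕ × List ℕ) (rest : List (List ℕ × List ℕ)) :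
    hasEmpty (st :: rest) = (List.rec (motive := fun _ => Bool) true (fun _ _ _ => false) st.1 || hasEmpty rest) :=
  rfl

/-! ## Bit lemmas -/

/-- Bits of a clause mask = membership. -/
theorem testBit_maskOf (C : List ℕ) (l : ℕ) : (maskOf C).testBit l = true ↔ l ∈ C := by
  induction C with
  | nil => simp [maskOf_nil]
  | cons a C ih =>
    rw [maskOf_cons, Nat.testBit_lor, Bool.or_eq_true, ih, Nat.testBit_two_pow]
    simp only [decide_eq_true_eq, List.mem_cons]
    constructor
    · rintro (h | h)
      · exact Or.inr h
      · exact Or.inl h.symm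
    · rintro (h | h)
      · exact Or.inr h.symm
      · exact Or.inl h

/-- Bits of the live part: set in `D`, not falsified. -/
theorem testBit_live (D F l : ℕ) : (live D F).testBit l = (D.testBit l && !F.testBit l) := by
  unfold live
  rw [show Nat.xor D (Nat.land D F) = D ^^^ (D &&& F) from rfl, Nat.testBit_xor, Nat.testBit_land]
  cases D.testBit l <;> cases F.testBit l <;> rfl

/-- Bits of `evenMask N`: the even positions below `2N`. -/
theorem testBit_evenMask (N j : ℕ) : (evenMask N).testBit j = true ↔ j % 2 = 0 ∧ j < 2 * N := by
  induction N with
  | zero => simp [evenMask]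
  | succ N ih =>
    rw [evenMask, Nat.testBit_lor, Bool.or_eq_true, ih, Nat.testBit_two_pow, decide_eq_true_eq]
    omega

/-- The swap of a single bit `2^u` (within range) has at most the partner bit `neg u` set. -/
theorem eq_neg_of_testBit_swapPair {E N u l : ℕ} (hE : E = evenMask N)
    (h : (swapPair E (2 ^ u)).testBit l = true) : l = KRup.neg u := by
  unfold swapPair at h
  rw [show Nat.lor (Nat.shiftLeft (Nat.land (2 ^ u) E) 1) (Nat.land (Nat.shiftRight (2 ^ u) 1) E) =
      ((2 ^ u &&& E) <<< 1) ||| ((2 ^ u >>> 1) &&& E) from rfl] at h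
  rw [Nat.testBit_lor, Bool.or_eq_true] at h
  unfold KRup.neg
  rcases h with h | h
  · rw [Nat.testBit_shiftLeft, Bool.and_eq_true, decide_eq_true_eq, Nat.testBit_land, Bool.and_eq_true,
      Nat.testBit_two_pow, decide_eq_true_eq, hE, testBit_evenMask] at h
    obtain ⟨hl, hu, he, -⟩ := h
    subst hu
    rw [if_pos he]
    omega
  · rw [Nat.testBit_land, Bool.and_eq_true, Nat.testBit_shiftRight, Nat.testBit_two_pow,
      decide_eq_true_eq, hE, testBit_evenMask] at h
    obtain ⟨hu, he, -⟩ := h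
    subst hu
    rw [if_neg (by omega)]
    omega

end Summit.Ventures.QEC.Census.KRupFast
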